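import Literature.NumberTheory.EllipticCurves.Pal2012.QuadraticTwistPeriodProofs
import Literature.NumberTheory.EllipticCurves.ManinConstantQuadraticTwistAtTwoOrdinaryProofs
import Literature.NumberTheory.EllipticCurves.BurungaleSkinnerTianWan2024.OrdinaryMainStatementTwistOfSkinnerUrbanProofs
import Literature.NumberTheory.EllipticCurves.QuadraticTwistProofs
import Literature.NumberTheory.EllipticCurves.PAdicLFunction
import Literature.NumberTheory.EllipticCurves.NoConductorOne
import Literature.NumberTheory.EllipticCurves.PrimeConductorTwoTorsionNormalFormProofs
import Literature.NumberTheory.QuadraticFields.QuadraticDedekindZeta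
import Summits.BirchSwinnertonDyer.BirchSwinnertonDyer.Theorems.ManinLocalTwoThreeManinOddAtFourEtaTwoMinimalTwist
import HarnessLib

/-!
# Ordinarity at `2` is stable under quadratic twists by `d ≡ 1 (mod 4)` — the Heegner-twin transport lemma
# for route `GenusKolyvaginAtTwo` (crux `MinimalTwinBSDTwo`, item stmt-BirchSwinnertonDyer-22985), route-independent

Cell `bsd-f1-sign2`, seat `bsd-line-gk2-p3` g6 (prover seat 3/3 on D-0145 line
`route-BirchSwinnertonDyer-GenusKolyvaginAtTwo`). SUPPORT file (`--supports stmt-BirchSwinnertonDyer-22985 --as helper`):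
THEOREMS ONLY, unconditional (no named fact, no `sorry`, no definition), and deliberately ROUTE-INDEPENDENT (imports:
Literature + one Literature-only Theorems file), so that any cell can import it. BSD is not proved by any of this.

WHY. Bridge 5 of crux #6 (`Theorems/GenusKolyvaginAtTwoMinimalTwinBSDTwoTwoAdic.lean`, p597746) reads the glue's
rank-one input on good-ORDINARY-at-2 twins `Wd ≅ E^{(d_K)}` off the cell's per-curve 2-adic pair; the habitat curve
`E` is the one whose reduction at `2` the census knows, so one needs «`E` ordinary at `2` ⟹ `E^{(d_K)}` ordinary at
`2`». For the route's Heegner fields `d_K` is ODD, hence `d_K ≡ 1 (mod 4)` and `ℚ(√d_K)/ℚ` is UNRAMIFIED at `2`: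
classically `a₂(E^{(d)}) = χ_d(2)·a₂(E) = ±a₂(E)`. The tree had this transport only at ODD primes `p ∤ d`
(`isOrdinaryAt_of_smul_eq_quadraticTwist`, `frobeniusTrace_quadraticTwist` with `p ∤ 2d`), and several `p = 2` files
carry «the twist is ordinary at `2`» as a binder (`hgoA`). This file proves it at `2`.

* §1 bookkeeping at the place of `ℚ` over `2` (`odd_iff_valuation_eq_one`, `intCast_c₄_integralModelInt`).
* §2 `odd_c₄_iff_of_smul_quadraticTwist_of_emod_four_eq_one` — `c₄(W) = u⁻⁴d²c₄(V)` with `u = u(C)` a `2`-adic unit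
  (Pal 2012 Prop. 2.5 «`d ≡ 1 mod 4 ⟹ u₂ = 1`», tree `valuation_u_eq_one_of_smul_quadraticTwist_two_of_emod_four_eq_one`),
  so the parity of `c₄` of the minimal equations agrees.
* §3 `isOrdinaryAt_two_iff_odd_a₁` — on a globally minimal equation with good reduction at `2`: ordinary ⟺ `a₁` odd
  (Silverman V.4: in characteristic `2`, supersingular ⟺ `j = ā₁¹²/Δ̄ = 0`); both halves were in the tree
  (`odd_a₁_of_hasGoodReductionAtPrime_two_of_odd_frobeniusTrace_two`, `even_reductionPointCount_two_of_odd_a₁`),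
  assembled here as an `↔`.
* §4 `hasGoodReductionAtPrime_two_of_smul_quadraticTwist_of_emod_four_eq_one` — good reduction at `2` passes to the
  twist (integral twist model `V.twistModel ((d−1)/4)`, same `ord₂ Δ_min`; the argument of the tree's
  `SignedBaseChangeK2RFrames.hasGoodReductionAtPrime_of_smul_eq_quadraticTwist_of_not_ramifiedInQuadratic` at `ℓ = 2`,
  re-proved here against route-independent imports).
* §5 `isOrdinaryAt_two_of_smul_quadraticTwist_of_emod_four_eq_one` (transport), `…_iff_…` (invariance, untwisting by
  `exists_smul_quadraticTwist_eq_of_smul_quadraticTwist_eq`), and the Heegner-twin form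
  `isOrdinaryAt_two_twin_iff_of_odd_discr` (`K` quadratic with odd `d_K`, `Wd` any globally minimal model of `W^{(d_K)}`).
  Chain: ordinary ⟺ `a₁` odd ⟺ `c₄` odd (`odd_c₄_int_of_odd_a₁`, `odd_a₁_of_odd_c₄`) and `c₄`-parity transports.

References: J. H. Silverman, *AEC* 2nd ed. (2009) V.4 (first paragraph), VII.1 Prop. 1.3(b), VII.5 Prop. 5.1(a),
X.2 Prop. 2.4 [SilvermanAEC2009]; V. Pal, *Periods of quadratic twists of elliptic curves*, Proc. AMS 140 (2012)
Prop. 2.4–2.5 [Pal2012]; I. Connell, *Elliptic Curve Handbook* §4.3 (integral twist model).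
-/

set_option autoImplicit false
set_option linter.dupNamespace false -- `Summit.BirchSwinnertonDyer.BirchSwinnertonDyer.…` is the tree's layout (D-0017)

noncomputable section

open scoped Classical

namespace Summit.BirchSwinnertonDyer.BirchSwinnertonDyer.Theorems.OrdinaryTwistAtTwo

open WeierstrassCurve IsDedekindDomain IsDedekindDomain.HeightOneSpectrum NumberField Rat.HeightOneSpectrum
  Literature.NumberTheory.EllipticCurves

/-! ## §1 Parity bookkeeping at the place of `ℚ` over `2` -/

/-- The finite place of `ℚ` over `2` (as an element of `HeightOneSpectrum (𝓞 ℚ)` with `primesEquiv v = 2`). [folklore] -/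
theorem exists_place_two : ∃ v : HeightOneSpectrum (𝓞 ℚ), (primesEquiv v : ℕ) = 2 :=
  ⟨(primesEquiv (R := 𝓞 ℚ)).symm ⟨2, Nat.prime_two⟩, by rw [Equiv.apply_symm_apply]⟩

/-- `c₄` of the integral model of a globally minimal equation, cast to `ℚ`, is `c₄` of the equation. [folklore] -/
theorem intCast_c₄_integralModelInt (W : WeierstrassCurve ℚ) [W.IsGloballyMinimal] :
    (((integralModelInt W).c₄ : ℤ) : ℚ) = W.c₄ := by
  have h := congrArg WeierstrassCurve.c₄ (map_integralModelInt W)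
  rwa [map_c₄, eq_intCast] at h

/-- An integer is odd iff its valuation at the place over `2` is `1`. [folklore] -/
theorem odd_iff_valuation_eq_one (v : HeightOneSpectrum (𝓞 ℚ)) (hv2 : (primesEquiv v : ℕ) = 2) (n : ℤ) :
    Odd n ↔ v.valuation ℚ (n : ℚ) = 1 := by
  constructor
  · intro hn
    refine valuation_ringOfIntegers_intCast_eq_one v ?_
    rw [hv2]
    exact_mod_cast fun h2 ↦ (Int.not_even_iff_odd.mpr hn) (even_iff_two_dvd.mpr h2)
  · intro h1
    by_contra hne
    have h2 : ((primesEquiv v : ℕ) : ℤ) ∣ n := by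
      rw [hv2]
      exact_mod_cast even_iff_two_dvd.mp (Int.not_odd_iff_even.mp hne)
    exact absurd h1 (valuation_ringOfIntegers_intCast_lt_one v h2).ne

/-! ## §2 `c₄`-parity is invariant under a quadratic twist by `d ≡ 1 (mod 4)` -/

/-- **`c₄` parity transports along a `2`-unramified quadratic twist.** `V/ℚ` globally minimal elliptic, `W` a
globally minimal model of `V^{(d)}` (`C • V^{(d)} = W`) with `d ≡ 1 (mod 4)`: `c₄` of the minimal equation of
`W` is odd iff `c₄` of that of `V` is. Indeed `c₄(W) = u⁻⁴ d² c₄(V)` (`variableChange_c₄`, `quadraticTwist_c₄`)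
and `u = u(C)` is a `2`-adic unit by Pal 2012 Prop. 2.5 (`d ≡ 1 mod 4 ⟹ u₂ = 1`, tree theorem
`valuation_u_eq_one_of_smul_quadraticTwist_two_of_emod_four_eq_one`). [cite: Pal2012, Prop. 2.5 (p = 2, d ≡ 1 mod 4)] -/
theorem odd_c₄_iff_of_smul_quadraticTwist_of_emod_four_eq_one
    (V W : WeierstrassCurve ℚ) [V.IsElliptic] [V.IsGloballyMinimal] [W.IsGloballyMinimal]
    {d : ℤ} (hd4 : d % 4 = 1) {C : VariableChange ℚ} (hC : C • V.quadraticTwist (d : ℚ) = W) :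
    Odd (integralModelInt W).c₄ ↔ Odd (integralModelInt V).c₄ := by
  obtain ⟨v, hv2⟩ := exists_place_two
  have hu : v.valuation ℚ (C.u : ℚ) = 1 :=
    V.valuation_u_eq_one_of_smul_quadraticTwist_two_of_emod_four_eq_one v hv2 hd4 W C hC
  have hd : v.valuation ℚ (d : ℚ) = 1 := by
    refine valuation_ringOfIntegers_intCast_eq_one v ?_
    rw [hv2]
    omega
  have hc₄ : W.c₄ = (C.u : ℚ)⁻¹ ^ 4 * ((d : ℚ) ^ 2 * V.c₄) := by
    rw [← hC, variableChange_c₄, quadraticTwist_c₄, Units.val_inv_eq_inv_val]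
  rw [odd_iff_valuation_eq_one v hv2, odd_iff_valuation_eq_one v hv2, intCast_c₄_integralModelInt,
    intCast_c₄_integralModelInt, hc₄, map_mul, map_mul, map_pow, map_pow, map_inv₀, hu, hd]
  simp

/-! ## §3 Good ordinary reduction at `2` read off the minimal equation: `a₁` odd -/

/-- **Ordinary at `2` ⟺ `a₁` odd** for a globally minimal elliptic `W/ℚ` with good reduction at `2`: in
characteristic `2` the reduction is supersingular iff `j = ā₁¹²/Δ̄ = 0` iff `ā₁ = 0`; equivalently `a₂(W) =
3 − #W̃(𝔽₂)` is odd iff `ā₁ = 1` (then `(ā₃, ·)` is a rational point of order `2`, so `#W̃(𝔽₂)` is even;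
else `ā₃ = 1` and no point has order `2`, so it is odd). Both halves are the tree's
(`odd_a₁_of_hasGoodReductionAtPrime_two_of_odd_frobeniusTrace_two`, `even_reductionPointCount_two_of_odd_a₁`);
assembled here. [cite: SilvermanAEC2009, V.4 (first paragraph) and Exercises 5.7, 5.10(a)] -/
theorem isOrdinaryAt_two_iff_odd_a₁ (W : WeierstrassCurve ℚ) [W.IsElliptic] [W.IsGloballyMinimal]
    (hgood : W.HasGoodReductionAtPrime 2) : IsOrdinaryAt W 2 ↔ Odd (integralModelInt W).a₁ := by
  constructor
  · rintro ⟨-, hnd⟩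
    refine odd_a₁_of_hasGoodReductionAtPrime_two_of_odd_frobeniusTrace_two W hgood ?_
    exact Int.not_even_iff_odd.mp fun h ↦ hnd (even_iff_two_dvd.mp h)
  · intro ha₁
    refine ⟨hgood, fun h2 ↦ ?_⟩
    obtain ⟨k, hk⟩ := Summit.BirchSwinnertonDyer.BirchSwinnertonDyer.Theorems.even_reductionPointCount_two_of_odd_a₁
      W hgood ha₁
    have hft : W.frobeniusTrace 2 = 3 - (W.reductionPointCount 2 : ℤ) := by
      rw [WeierstrassCurve.frobeniusTrace]; push_cast; ring
    rw [hft, hk] at h2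
    omega

/-! ## §4 Good reduction at `2` passes to a twist by `d ≡ 1 (mod 4)` -/

/-- **Good reduction at `2` is inherited by a quadratic twist by `d ≡ 1 (mod 4)`** (the twist is UNRAMIFIED at
`2`). `V/ℚ` globally minimal elliptic with good reduction at `2`, `W` a globally minimal elliptic model of
`V^{(d)}`, `C • V^{(d)} = W`: then `W` has good reduction at `2`. Proof as the tree's
`SignedBaseChangeK2RFrames.hasGoodReductionAtPrime_of_smul_eq_quadraticTwist_of_not_ramifiedInQuadratic` (cell
bsd-wall-sbc), specialised to `ℓ = 2` and restated against a route-independent import set: with `k = (d−1)/4 ∈ ℤ`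
the integral twist model `V.twistModel k` is a `ℚ`-model of `V^{(d)}` with the same `ord₂ Δ_min` as `V`
(`ordMinimalDiscriminant_twistModel`), `ord₂ Δ_min` is a `ℚ`-isomorphism invariant (`ordMinimalDiscriminant_smul`),
and good reduction is `ord₂ Δ_min = 0`. [cite: SilvermanAEC2009, VII.1 Prop. 1.3(b) and VII.5 Prop. 5.1(a)] -/
theorem hasGoodReductionAtPrime_two_of_smul_quadraticTwist_of_emod_four_eq_one
    (V W : WeierstrassCurve ℚ) [V.IsElliptic] [V.IsGloballyMinimal] [W.IsElliptic] [W.IsGloballyMinimal]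
    {d : ℤ} (hd4 : d % 4 = 1) {C : VariableChange ℚ} (hC : C • V.quadraticTwist (d : ℚ) = W)
    (hgood : V.HasGoodReductionAtPrime 2) : W.HasGoodReductionAtPrime 2 := by
  -- the place `u` of `ℤ` below `2`
  set u : HeightOneSpectrum ℤ := (primesEquiv (R := ℤ)).symm ⟨2, Nat.prime_two⟩ with hu
  have hpu : primesEquiv u = ⟨2, Nat.prime_two⟩ := (primesEquiv (R := ℤ)).apply_symm_apply ⟨2, Nat.prime_two⟩
  have hℓu : natGenerator u = 2 := congrArg Subtype.val hpu
  -- the twisting parameter `k = (d - 1)/4 ∈ ℤ`, `4k + 1 = d`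
  have h4 : (4 : ℤ) ∣ d - 1 := by omega
  obtain ⟨m, hm⟩ := h4
  set k : ℚ := ((d : ℚ) - 1) / 4 with hk
  have hk4 : 4 * k + 1 = (d : ℚ) := by rw [hk]; ring
  have hkm : k = (m : ℚ) := by
    rw [hk]
    have : ((d : ℚ) - 1) = 4 * (m : ℚ) := by exact_mod_cast hm
    rw [this]; ring
  have hvd : u.valuation ℚ (4 * k + 1) = 1 := by
    rw [hk4, show ((d : ℚ)) = algebraMap ℤ ℚ d from rfl, HeightOneSpectrum.valuation_of_algebraMap]
    refine intValuation_eq_one_of_not_dvd u ?_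
    rw [hℓu]
    omega
  have hvk : u.valuation ℚ k ≤ 1 := by
    rw [hkm, show ((m : ℚ)) = algebraMap ℤ ℚ m from rfl, HeightOneSpectrum.valuation_of_algebraMap]
    exact HeightOneSpectrum.intValuation_le_one u m
  -- the integral twist model is a `ℚ`-model of `V^{(d)}`, hence `ℚ`-isomorphic to `W`
  obtain ⟨C', -, hC'⟩ := V.exists_variableChange_twistModel_eq_quadraticTwist k
  rw [hk4] at hC'
  have hW : W = (C * C') • V.twistModel k := by rw [mul_smul, hC', hC]
  -- `ord₂ Δ_min`: `W` = twist model = `V`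
  have hordW : W.ordMinimalDiscriminant u = V.ordMinimalDiscriminant u := by
    rw [hW, ordMinimalDiscriminant_smul_holds u (V.twistModel k) (C * C'),
      ordMinimalDiscriminant_twistModel u V hvk hvd]
  -- good reduction ↔ `ord Δ_min = 0`
  have h0 : V.ordMinimalDiscriminant u = 0 := by
    have hg : V.HasGoodReductionAt u := by
      have h := hasGoodReductionAtPrime_primesEquiv_iff_hasGoodReductionAt V u
      rw [hpu] at h
      exact h.mp hgood
    exact (ordMinimalDiscriminant_eq_zero_iff_holds u V).mpr hg
  have hgW : W.HasGoodReductionAt u :=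
    (ordMinimalDiscriminant_eq_zero_iff_holds u W).mp (by rw [hordW, h0])
  have h := hasGoodReductionAtPrime_primesEquiv_iff_hasGoodReductionAt W u
  rw [hpu] at h
  exact h.mpr hgW

/-! ## §5 Ordinarity at `2` is stable under quadratic twists by `d ≡ 1 (mod 4)` -/

/-- **Good ORDINARY reduction at `2` is inherited by a quadratic twist by `d ≡ 1 (mod 4)`.** `V/ℚ` globally
minimal, good ordinary at `2` (`IsOrdinaryAt V 2`: good reduction and `2 ∤ a₂(V)`); `W` a globally minimal elliptic
model of `V^{(d)}` (`C • V^{(d)} = W`), `d ≡ 1 (mod 4)` (so `ℚ(√d)/ℚ` is unramified at `2`). Then `W` is good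
ordinary at `2`. Proof: good reduction transports (§4); ordinary ⟺ `a₁` odd ⟺ `c₄` odd on the minimal
equations (§3, `odd_c₄_int_of_odd_a₁`, `odd_a₁_of_odd_c₄`), and `c₄`-parity transports (§2). (Classically:
`a₂(E^{(d)}) = χ_d(2)·a₂(E) = ±a₂(E)` for the unramified character `χ_d`.) This discharges the «twist is ordinary
at 2» binders carried as hypotheses elsewhere in the tree (e.g. `hgoA` in the `TwoAdicConverse…TwistDescent` /
`ByReductionTypeAtTwoOrdHalvesTwistTransport` files) whenever `d ≡ 1 (mod 4)`.
[cite: SilvermanAEC2009, V.4 (first paragraph), VII.1 Prop. 1.3(b), X.2 Prop. 2.4] [cite: Pal2012, Prop. 2.5] -/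
theorem isOrdinaryAt_two_of_smul_quadraticTwist_of_emod_four_eq_one
    (V W : WeierstrassCurve ℚ) [V.IsElliptic] [V.IsGloballyMinimal] [W.IsElliptic] [W.IsGloballyMinimal]
    {d : ℤ} (hd4 : d % 4 = 1) {C : VariableChange ℚ} (hC : C • V.quadraticTwist (d : ℚ) = W)
    (hV : IsOrdinaryAt V 2) : IsOrdinaryAt W 2 := by
  have hgoodW : W.HasGoodReductionAtPrime 2 :=
    hasGoodReductionAtPrime_two_of_smul_quadraticTwist_of_emod_four_eq_one V W hd4 hC hV.1
  have ha₁V : Odd (integralModelInt V).a₁ := (isOrdinaryAt_two_iff_odd_a₁ V hV.1).mp hV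
  have hc₄V : Odd (integralModelInt V).c₄ := WeierstrassCurve.odd_c₄_int_of_odd_a₁ _ ha₁V
  have hc₄W : Odd (integralModelInt W).c₄ :=
    (odd_c₄_iff_of_smul_quadraticTwist_of_emod_four_eq_one V W hd4 hC).mpr hc₄V
  have ha₁W : Odd (integralModelInt W).a₁ := PrimeConductorTwoTorsion.odd_a₁_of_odd_c₄ _ hc₄W
  exact (isOrdinaryAt_two_iff_odd_a₁ W hgoodW).mpr ha₁W

/-- **A twist by `d ≡ 1 (mod 4)` can be untwisted**: if `C • V^{(d)} = W` then `C'' • W^{(d)} = V` for some `C''`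
(`(V^{(d)})^{(d)} = V^{(d²)} ≅ V`, `quadraticTwist_smul`, `exists_quadraticTwist_quadraticTwist_eq_smul`). [folklore] -/
theorem exists_smul_quadraticTwist_eq_of_smul_quadraticTwist_eq (V W : WeierstrassCurve ℚ)
    {d : ℚ} (hd : d ≠ 0) {C : VariableChange ℚ} (hC : C • V.quadraticTwist d = W) :
    ∃ C'' : VariableChange ℚ, C'' • W.quadraticTwist d = V := by
  obtain ⟨D, hD⟩ := exists_quadraticTwist_quadraticTwist_eq_smul V hd
  refine ⟨((⟨C.u, d * C.r, 0, 0⟩ : VariableChange ℚ) * D)⁻¹, ?_⟩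
  rw [← hC, quadraticTwist_smul, hD, smul_smul, smul_smul, mul_assoc, inv_mul_cancel, one_smul]

/-- **Ordinarity at `2` is INVARIANT under quadratic twists by `d ≡ 1 (mod 4)`** (both directions of
`isOrdinaryAt_two_of_smul_quadraticTwist_of_emod_four_eq_one`, untwisting by
`exists_smul_quadraticTwist_eq_of_smul_quadraticTwist_eq`). [cite: SilvermanAEC2009, V.4 and X.2 Prop. 2.4]
[cite: Pal2012, Prop. 2.5] -/
theorem isOrdinaryAt_two_iff_of_smul_quadraticTwist_of_emod_four_eq_one
    (V W : WeierstrassCurve ℚ) [V.IsElliptic] [V.IsGloballyMinimal] [W.IsElliptic] [W.IsGloballyMinimal]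
    {d : ℤ} (hd4 : d % 4 = 1) {C : VariableChange ℚ} (hC : C • V.quadraticTwist (d : ℚ) = W) :
    IsOrdinaryAt W 2 ↔ IsOrdinaryAt V 2 := by
  have hd0 : (d : ℚ) ≠ 0 := by
    have : d ≠ 0 := by omega
    exact_mod_cast this
  obtain ⟨C'', hC''⟩ := exists_smul_quadraticTwist_eq_of_smul_quadraticTwist_eq V W hd0 hC
  exact ⟨fun hW ↦ isOrdinaryAt_two_of_smul_quadraticTwist_of_emod_four_eq_one W V hd4 hC'' hW,
    fun hV ↦ isOrdinaryAt_two_of_smul_quadraticTwist_of_emod_four_eq_one V W hd4 hC hV⟩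

/-- **The Heegner-twin form.** For a quadratic field `K` with ODD discriminant `d_K` (hence
`d_K ≡ 1 (mod 4)`, Stickelberger; tree `Quadratic.discr_emod_four_eq_one`), a globally minimal elliptic `W` and
a globally minimal elliptic model `Wd` of `W^{(d_K)}`: `Wd` is good ordinary at `2` iff `W` is — the shape in which
route `GenusKolyvaginAtTwo` meets its twins (`K` the Heegner field, `d_K` odd by crux #2's binder).
[cite: SilvermanAEC2009, V.4 and X.2 Prop. 2.4] -/
theorem isOrdinaryAt_two_twin_iff_of_odd_discr (W : WeierstrassCurve ℚ) [W.IsElliptic] [W.IsGloballyMinimal]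
    (K : Type) [Field K] [NumberField K] (h2 : Module.finrank ℚ K = 2) (hodd : Odd (NumberField.discr K))
    (Wd : WeierstrassCurve ℚ) [Wd.IsElliptic] [Wd.IsGloballyMinimal]
    (hWd : ∃ C : VariableChange ℚ, C • W.quadraticTwist (NumberField.discr K : ℚ) = Wd) :
    IsOrdinaryAt Wd 2 ↔ IsOrdinaryAt W 2 := by
  obtain ⟨C, hC⟩ := hWd
  exact isOrdinaryAt_two_iff_of_smul_quadraticTwist_of_emod_four_eq_one W Wd
    (Literature.NumberTheory.QuadraticFields.Quadratic.discr_emod_four_eq_one h2 hodd) hC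

end Summit.BirchSwinnertonDyer.BirchSwinnertonDyer.Theorems.OrdinaryTwistAtTwo

end
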